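import Summits.SmoothPoincare4.SmoothPoincare4.Theses.SblfDescent
import Literature.Topology.FourManifolds.SimplifiedBrokenLefschetzFibration

/-!
# `StepGE3`: load-bearing hypotheses, exclusive genus flags, and the "broken genus ≤ 2" form

Negative side of crux `SblfDescent.StepGE3` (item stmt-SmoothPoincare4-18528, cdisprove cycle 1),
kernel-checked over the tree's own vocabulary
(`Literature.Topology.FourManifolds.IsSimplifiedBrokenLefschetzFibration o f L n` = the route's inline
`HAS(M, n)`, field for field):

* `genusFlag_unique`, `not_both_genera` — the route reads "the regular fibre over `y` has genus `n`" as
  `Nonempty ((Fin (2 * n) → ℤ) ≃ₗ[ℤ] H₁(f ⁻¹' {y}; ℤ))`; by invariant basis number over `ℤ` a fibre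
  carries at most one genus flag, so the disjunction "genus `h + 1` or `h`" in the crux is exclusive
  (no junk in the genus encoding; "higher side"/"lower side" are well defined value by value).
* `stepGE3_without_homotopyEquiv_false_of_gap` — **`M ≃ₕ S⁴` is load-bearing**: ANY smooth
  4-manifold with a broken-genus gap (an SBLF of lower genus `g ≥ 2`, none of lower genus `g − 1`)
  refutes the crux with `M ≃ₕ S⁴` deleted.  Paper witnesses (not constructible in the tree, hence
  hypotheses here): `S² × Σ_g` (Baykur 2012, Prop. 10 with Lemmas 7, 12) and `T⁴ # S¹×S³` (Lemma 8).
* `hasSblf_one_of_stepGE3` / `stepGE3_of_hasSblf_one` — **equivalent form**: `StepGE3` implies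
  outright that a homotopy 4-sphere with an SBLF of some lower genus `n ≥ 2` has one of lower genus `1`
  ("broken genus ≤ 2"), and conversely GIVEN flip-and-slip monotonicity on homotopy spheres
  (Baykur 2012, Lemma 12, an explicit hypothesis) that statement gives `StepGE3` back.  So, modulo
  Lemma 12, the crux says exactly: no smooth homotopy 4-sphere has broken genus `≥ 3`.

Refuter negative lemmas (crux-attack); no Theses decl is asserted; statements with a clause removed are
written VERBATIM inline (no new `def`).
-/

noncomputable section

-- `Summit.SmoothPoincare4.SmoothPoincare4.…` (summit = sub-problem) trips `dupNamespace`.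
set_option linter.dupNamespace false

open scoped Manifold ContDiff Topology ContinuousMap
open Literature.Topology.FourManifolds

namespace Summit.SmoothPoincare4.SmoothPoincare4.Theorems.StepGE3.Negative

open Summit.SmoothPoincare4.SmoothPoincare4.Theses.SblfDescent

/-! ### The genus flags are exclusive -/

/-- **Invariant basis number for the genus flag.**  If `ℤ^{2n} ≃ₗ[ℤ] V` and `ℤ^{2m} ≃ₗ[ℤ] V` then
`n = m`. [folklore] -/
theorem genusFlag_unique {V : Type*} [AddCommGroup V] [Module ℤ V] {n m : ℕ}
    (hn : Nonempty ((Fin (2 * n) → ℤ) ≃ₗ[ℤ] V)) (hm : Nonempty ((Fin (2 * m) → ℤ) ≃ₗ[ℤ] V)) :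
    n = m := by
  obtain ⟨e₁⟩ := hn
  obtain ⟨e₂⟩ := hm
  have h := (e₁.trans e₂.symm).finrank_eq
  simp only [Module.finrank_fin_fun] at h
  omega

/-- **No regular fibre is simultaneously of genus `h + 1` and `h`**: the disjunction in the `fibre`
clause of the crux (`G y (h + 1) ∨ G y h`) is exclusive. [folklore] -/
theorem not_both_genera {X : Type} [TopologicalSpace X]
    {f : X → Metric.sphere (0 : EuclideanSpace ℝ (Fin 3)) 1} {h : ℕ}
    (y : Metric.sphere (0 : EuclideanSpace ℝ (Fin 3)) 1) :
    ¬ (Nonempty ((Fin (2 * (h + 1)) → ℤ) ≃ₗ[ℤ]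
          Literature.AlgebraicTopology.SingularHomology.singularHomology ℤ ℤ ↥(f ⁻¹' {y}) 1) ∧
       Nonempty ((Fin (2 * h) → ℤ) ≃ₗ[ℤ]
          Literature.AlgebraicTopology.SingularHomology.singularHomology ℤ ℤ ↥(f ⁻¹' {y}) 1)) :=
  fun hh ↦ absurd (genusFlag_unique hh.1 hh.2) (Nat.succ_ne_self h)

/-! ### `M ≃ₕ S⁴` is load-bearing -/

/-- **`M ≃ₕ S⁴` is load-bearing — kernel form.**  ANY smooth 4-manifold `M` with a broken-genus gap
(an SBLF with non-empty round locus of lower genus `g ≥ 2` but none of lower genus `g − 1`) refutes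
the crux with the hypothesis `M ≃ₕ S⁴` deleted (the statement in the conclusion, negated, is
`StepGE3` verbatim over the tree vocabulary without `M ≃ₕ S⁴`).  PAPER WITNESS (not constructible in
the tree: no `Σ_g`, no product atlas on `ℝ⁴`, no general Euler count): `M = S² × Σ_g`, `g ≥ 2` —
Baykur 2012 (arXiv:1205.5439), Prop. 10 verbatim: *"`g(S² × Σ_g) = g` for any non-negative integer
`g`"*, with Lemma 12 (*"If it admits a genus `g` SBLF, then it admits a genus `g+1` SPWF"*, hence an
SBLF of genus `g + 1`, lower genus `g`, whose round locus is the flip-and-slip circle; `k = 2`) for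
`hex`, and Lemma 7 (*"`e(X) = 6 − 4g + k`"* for non-empty round locus) for `hno`: lower genus `g − 1`
is genus `g`, and `6 − 4g + k = e(S² × Σ_g) = 4 − 4g` forces `k = −2 < 0`.  Second family:
`b₁(M) > 2g` excludes genus `≤ g` (Lemma 8: *"`2g ≥ b₁(X)`"*), e.g. `T⁴ # S¹ × S³` (`b₁ = 5`).
[cite: Baykur2012, Prop. 10, Lemma 7, Lemma 8, Lemma 12] -/
theorem stepGE3_without_homotopyEquiv_false_of_gap
    (M : Type) [TopologicalSpace M] [T2Space M] [SecondCountableTopology M]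
    [ChartedSpace (EuclideanSpace ℝ (Fin 4)) M] [IsManifold (𝓡 4) ∞ M] (g : ℕ) (hg : 2 ≤ g)
    (hex : ∃ (o : SmoothOrientation (𝓡 4) M) (f : M → Metric.sphere (0 : EuclideanSpace ℝ (Fin 3)) 1)
      (L : Finset M), IsSimplifiedBrokenLefschetzFibration o f L g)
    (hno : ¬ ∃ (o : SmoothOrientation (𝓡 4) M) (f : M → Metric.sphere (0 : EuclideanSpace ℝ (Fin 3)) 1)
      (L : Finset M), IsSimplifiedBrokenLefschetzFibration o f L (g - 1)) :
    ¬ (∀ (M : Type) [TopologicalSpace M] [T2Space M] [SecondCountableTopology M]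
        [ChartedSpace (EuclideanSpace ℝ (Fin 4)) M] [IsManifold (𝓡 4) ∞ M],
        ∀ h : ℕ, 1 ≤ h →
        (∃ (o : SmoothOrientation (𝓡 4) M) (f : M → Metric.sphere (0 : EuclideanSpace ℝ (Fin 3)) 1)
          (L : Finset M), IsSimplifiedBrokenLefschetzFibration o f L (h + 1)) →
        (∃ (o : SmoothOrientation (𝓡 4) M) (f : M → Metric.sphere (0 : EuclideanSpace ℝ (Fin 3)) 1)
          (L : Finset M), IsSimplifiedBrokenLefschetzFibration o f L h)) := by
  intro W
  obtain ⟨d, rfl⟩ : ∃ d, g = d + 1 := ⟨g - 1, by omega⟩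
  exact hno (by simpa using W M d (by omega) hex)

/-! ### Equivalent form: broken genus ≤ 2 on homotopy 4-spheres -/

/-- Reading of the crux over the tree vocabulary (the route's inline block is the list of the ten
fields of `IsSimplifiedBrokenLefschetzFibration`, in order). [folklore] -/
private theorem stepGE3_iff_aux : StepGE3 ↔
    ∀ (M : Type) [TopologicalSpace M] [T2Space M] [SecondCountableTopology M]
      [ChartedSpace (EuclideanSpace ℝ (Fin 4)) M] [IsManifold (𝓡 4) ∞ M],
      M ≃ₕ Metric.sphere (0 : EuclideanSpace ℝ (Fin 5)) 1 → ∀ h : ℕ, 1 ≤ h →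
        (∃ (o : SmoothOrientation (𝓡 4) M) (f : M → Metric.sphere (0 : EuclideanSpace ℝ (Fin 3)) 1)
          (L : Finset M), IsSimplifiedBrokenLefschetzFibration o f L (h + 1)) →
        (∃ (o : SmoothOrientation (𝓡 4) M) (f : M → Metric.sphere (0 : EuclideanSpace ℝ (Fin 3)) 1)
          (L : Finset M), IsSimplifiedBrokenLefschetzFibration o f L h) := by
  constructor
  · intro H M _ _ _ _ _ e h hh hM
    obtain ⟨o, f, L, ⟨h1, h2, h3, h4, h5, h6, h7, h8, h9, h10⟩⟩ := hM
    obtain ⟨o', f', L', h1, h2, h3, h4, h5, h6, h7, h8, h9, h10⟩ :=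
      H M e h hh ⟨o, f, L, h1, h2, h3, h4, h5, h6, h7, h8, h9, h10⟩
    exact ⟨o', f', L', ⟨h1, h2, h3, h4, h5, h6, h7, h8, h9, h10⟩⟩
  · intro H M _ _ _ _ _ e h hh hM
    obtain ⟨o, f, L, h1, h2, h3, h4, h5, h6, h7, h8, h9, h10⟩ := hM
    obtain ⟨o', f', L', ⟨h1, h2, h3, h4, h5, h6, h7, h8, h9, h10⟩⟩ :=
      H M e h hh ⟨o, f, L, ⟨h1, h2, h3, h4, h5, h6, h7, h8, h9, h10⟩⟩
    exact ⟨o', f', L', h1, h2, h3, h4, h5, h6, h7, h8, h9, h10⟩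

/-- **`StepGE3` ⇒ "broken genus ≤ 2 on homotopy 4-spheres"**, outright: a smooth `M ≃ₕ S⁴` carrying
an SBLF (non-empty round locus) of some lower genus `n ≥ 1` carries one of lower genus `1` (genus
`2`) — iterate the descent from `n` down to `1`. [folklore] -/
theorem hasSblf_one_of_stepGE3 (h3 : StepGE3)
    (M : Type) [TopologicalSpace M] [T2Space M] [SecondCountableTopology M]
    [ChartedSpace (EuclideanSpace ℝ (Fin 4)) M] [IsManifold (𝓡 4) ∞ M]
    (e : M ≃ₕ Metric.sphere (0 : EuclideanSpace ℝ (Fin 5)) 1) (n : ℕ) (hn : 1 ≤ n)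
    (hM : ∃ (o : SmoothOrientation (𝓡 4) M) (f : M → Metric.sphere (0 : EuclideanSpace ℝ (Fin 3)) 1)
      (L : Finset M), IsSimplifiedBrokenLefschetzFibration o f L n) :
    ∃ (o : SmoothOrientation (𝓡 4) M) (f : M → Metric.sphere (0 : EuclideanSpace ℝ (Fin 3)) 1)
      (L : Finset M), IsSimplifiedBrokenLefschetzFibration o f L 1 := by
  rw [stepGE3_iff_aux] at h3
  have key : ∀ d : ℕ,
      (∃ (o : SmoothOrientation (𝓡 4) M) (f : M → Metric.sphere (0 : EuclideanSpace ℝ (Fin 3)) 1)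
        (L : Finset M), IsSimplifiedBrokenLefschetzFibration o f L (d + 1)) →
      ∃ (o : SmoothOrientation (𝓡 4) M) (f : M → Metric.sphere (0 : EuclideanSpace ℝ (Fin 3)) 1)
        (L : Finset M), IsSimplifiedBrokenLefschetzFibration o f L 1 := by
    intro d
    induction d with
    | zero => exact id
    | succ d ih => exact fun hd ↦ ih (h3 M e (d + 1) (Nat.succ_le_succ (Nat.zero_le d)) hd)
  obtain ⟨d, rfl⟩ : ∃ d, n = d + 1 := ⟨n - 1, by omega⟩
  exact key d hM

/-- **Conversely, GIVEN flip-and-slip monotonicity** on homotopy 4-spheres (`hr`, Baykur 2012,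
Lemma 12: an SBLF of lower genus `n` yields one of lower genus `n + 1`; the round locus stays
non-empty — an explicit hypothesis, not asserted), "broken genus ≤ 2" gives `StepGE3` back: descend
to lower genus `1`, then climb to `h`.  So modulo Lemma 12 the crux is EXACTLY the statement that no
smooth homotopy 4-sphere has broken genus `≥ 3`. [cite: Baykur2012, Lemma 12] -/
theorem stepGE3_of_hasSblf_one
    (hr : ∀ (M : Type) [TopologicalSpace M] [T2Space M] [SecondCountableTopology M]
      [ChartedSpace (EuclideanSpace ℝ (Fin 4)) M] [IsManifold (𝓡 4) ∞ M],
      M ≃ₕ Metric.sphere (0 : EuclideanSpace ℝ (Fin 5)) 1 → ∀ n : ℕ,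
        (∃ (o : SmoothOrientation (𝓡 4) M) (f : M → Metric.sphere (0 : EuclideanSpace ℝ (Fin 3)) 1)
          (L : Finset M), IsSimplifiedBrokenLefschetzFibration o f L n) →
        (∃ (o : SmoothOrientation (𝓡 4) M) (f : M → Metric.sphere (0 : EuclideanSpace ℝ (Fin 3)) 1)
          (L : Finset M), IsSimplifiedBrokenLefschetzFibration o f L (n + 1)))
    (h2 : ∀ (M : Type) [TopologicalSpace M] [T2Space M] [SecondCountableTopology M]
      [ChartedSpace (EuclideanSpace ℝ (Fin 4)) M] [IsManifold (𝓡 4) ∞ M],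
      M ≃ₕ Metric.sphere (0 : EuclideanSpace ℝ (Fin 5)) 1 → ∀ n : ℕ, 2 ≤ n →
        (∃ (o : SmoothOrientation (𝓡 4) M) (f : M → Metric.sphere (0 : EuclideanSpace ℝ (Fin 3)) 1)
          (L : Finset M), IsSimplifiedBrokenLefschetzFibration o f L n) →
        (∃ (o : SmoothOrientation (𝓡 4) M) (f : M → Metric.sphere (0 : EuclideanSpace ℝ (Fin 3)) 1)
          (L : Finset M), IsSimplifiedBrokenLefschetzFibration o f L 1)) :
    StepGE3 := by
  rw [stepGE3_iff_aux]
  intro M _ _ _ _ _ e h hh hM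
  have h1 : ∃ (o : SmoothOrientation (𝓡 4) M) (f : M → Metric.sphere (0 : EuclideanSpace ℝ (Fin 3)) 1)
      (L : Finset M), IsSimplifiedBrokenLefschetzFibration o f L 1 := h2 M e (h + 1) (by omega) hM
  have key : ∀ d : ℕ, ∃ (o : SmoothOrientation (𝓡 4) M)
      (f : M → Metric.sphere (0 : EuclideanSpace ℝ (Fin 3)) 1) (L : Finset M),
      IsSimplifiedBrokenLefschetzFibration o f L (d + 1) := by
    intro d
    induction d with
    | zero => exact h1
    | succ d ih => exact hr M e (d + 1) ih
  obtain ⟨d, rfl⟩ : ∃ d, h = d + 1 := ⟨h - 1, by omega⟩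
  exact key d

end Summit.SmoothPoincare4.SmoothPoincare4.Theorems.StepGE3.Negative

end
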